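import Summits.QuantumFields.YangMills.Theorems.SwapVirialDeficitBlowUpPeriodicScaling
import Summits.QuantumFields.YangMills.Theorems.SwapVirialDeficitZeroModeGroupConeRadial
import Summits.QuantumFields.YangMills.Theorems.SwapVirialDeficitZeroModeGroupFourSmallBallTwoScale
import HarnessLib

/-!
# The PERIODIC massive-mode rung, brick PH: the HUB IN RADIAL COORDINATES — the log-squeeze kernel `K_t(a₀, ρ)` of the zero-flux ring and the
# hub-dependent second rescaling for integrands
# (free-hands support of ⟨stmt-QuantumFields-24196⟩ `SwapVirialDeficit.ToronSoftnessSharp`; memo `w3-g64-memo-24196-periodic-massive-mode-rung.md` §2 PH;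
# consumes ✓PS `BlowUpRing.ringMeasure_ringDeficit_le_eq_hub`, fcl-p3 g44's ✓`ZeroModeGroup.lintegral_coneMeasure_re_normSqIm'` (K4 VII) and
# ✓`map_scaleQ3_volume` (K4 III); feeds ✓`BlowUp.tendsto_div_log_of_twoScale`)

After PS the periodic sublevel volume is `ofReal(coneConst^{6L⁴}·t^{18L⁴−3}) · ∫⁻ a, Ψ_t(a) ∂cone` with the FIBRE MASS
`Ψ_t(a) = ∫⁻ w, vol^{Fol}(section of periodicBlowUpSet at (a, w)) dvol³`.  Since the periodic leader chart straightens the hub (letter `3` is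
`Q(axisPoint a)`, `axisPoint a = re a + ‖Im a‖·i`), `Ψ_t` depends on `a` only through `(a₀, ‖Im a‖²)`:
* §1 `hubAt a₀ σ := (a₀, √σ, 0, 0) ∈ ℍ` (`axisPoint a = hubAt a.re ‖Im a‖²`), `periodicFibreMass z χ t s a` (= `Ψ_t(a)`), measurability,
  ★ `periodicFibreMass_eq_hubAt` (`Ψ_t(a) = Ψ_t(hubAt a₀ ‖Im a‖²)`);
* §2 ★★ `periodicKernel z χ t s (a₀, ρ) := ofReal(4π)·𝟙{a₀² + ρ² < 1}·ofReal(ρ²)·Ψ_t(hubAt a₀ ρ²)` and ★★★ `ringMeasure_ringDeficit_le_eq_kernel`: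
  `μ_L{F_z ≤ s} = ofReal(coneConst^{6L⁴+1}·t^{18L⁴−3}) · ∫⁻ a₀, (∫⁻ ρ in Ioi 0, periodicKernel z χ t s (a₀, ρ)) ∂vol` — LITERALLY the shape
  `∫⁻ x, (∫⁻ ρ in Ioi 0, K t (x, ρ)) ∂σ` of ✓`BlowUp.tendsto_div_log_of_twoScale` with `X = ℝ ∋ a₀`, `σ = vol`; `measurable_periodicKernel`;
* §3 ★ `lintegral_volume3_eq_scaleQ3` — fcl-p3 g44's hub-dependent second rescaling `scaleQ3 m l` (K4 III) for INTEGRANDS: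
  `∫⁻ H dvol³ = ofReal(|m·l²|³) · ∫⁻ H ∘ scaleQ3 m l dvol³` (leaders only; the followers are never rescaled a second time, memo §3(ii)).
Deliberately NOT here: which `(m, l)` to choose at hub `(a₀, ρ)` for the full ring (PM's design: K4 takes `m = ‖a‖/(2a_I)`-type, ✓`volume_rescaledSet4_eq_twoScale`),
the deep/outer bounds (PD), the two-scale limit (PM).
HONEST LABEL: measure-theoretic bookkeeping (plumbing for a plan-level fixed-`L` rung of a DRAFT line); NOT ⟨24196⟩/⟨24497⟩; own crux ⟨22884⟩ OPEN (blocked-on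
⟨19935⟩); the Yang–Mills mass gap is NOT proved; no summit is proved by a line.
Width seat ym-line-sfw-p2-w3 g64 (cell ym-idea-1, free hands), `--supports stmt-QuantumFields-24196`.  Three `def`s, standard axioms, 0 `sorry`.
References: [cite: Luscher1983, §2]; [cite: GonzalezarroyoAltes1988]; [folklore].
-/

set_option autoImplicit false

noncomputable section

open MeasureTheory Quaternion Set
open scoped Quaternion ENNReal BigOperators
open Literature.MathematicalPhysics.QuantumLattice
open Literature.MathematicalPhysics.QuantumFieldTheory hiding SU2
open Summit.QuantumFields.YangMills.Theorems.SwapTwistDeficit.ToronLog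

attribute [local instance] Literature.Analysis.FluidPDE.Tao2016.quatMeasurableSpace
  Literature.Analysis.FluidPDE.Tao2016.quatBorelSpace
  Literature.MathematicalPhysics.QuantumLattice.secondCountableTopology_su2

namespace Summit.QuantumFields.YangMills.Theorems.SwapVirialDeficit.BlowUpRing

open Summit.QuantumFields.YangMills.Theorems.FemtoTransferGap
open Summit.QuantumFields.YangMills.Theorems.FemtoTransferGap.TT
open Summit.QuantumFields.YangMills.Theorems.VirialFluxGap.RingDeficit
open Summit.QuantumFields.YangMills.Theorems.SwapVirialDeficit.ZeroModeSigma (ball3 measurableSet_ball3 dilateIm continuous_dilateIm)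
open Summit.QuantumFields.YangMills.Theorems.SwapVirialDeficit.ZeroModeGroup (lintegral_coneMeasure_re_normSqIm' scaleQ3 measurable_scaleQ3 map_scaleQ3_volume)
open Summit.QuantumFields.YangMills.Theorems.SwapVirialDeficit.BlowUp (axialLetters measurable_axialLetters dil3P measurable_dil3P)

variable {L : ℕ} [NeZero L]

/-! ## §1 The fibre mass and its dependence on the hub through `(a₀, ‖Im a‖²)` -/

/-- The axial hub with prescribed real part `a₀` and squared imaginary norm `σ`: `hubAt a₀ σ = (a₀, √σ, 0, 0)`. [folklore] -/
def hubAt (a₀ σ : ℝ) : ℍ := ⟨a₀, Real.sqrt σ, 0, 0⟩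

/-- `axisPoint a = hubAt a.re ‖Im a‖²`. [folklore] -/
theorem axisPoint_eq_hubAt (a : ℍ) : axisPoint a = hubAt a.re (‖a.im‖ ^ 2) := by
  rw [hubAt, Real.sqrt_sq (norm_nonneg _)]; rfl

/-- `axisPoint (hubAt a₀ σ) = hubAt a₀ σ`: the prescribed hub is already axial. [folklore] -/
theorem axisPoint_hubAt (a₀ σ : ℝ) : axisPoint (hubAt a₀ σ) = hubAt a₀ σ := by
  have h2 : ‖(hubAt a₀ σ).im‖ ^ 2 = Real.sqrt σ ^ 2 := by
    rw [Summit.QuantumFields.YangMills.Theorems.WeakCouplingRates.sq_norm_im]; simp [hubAt]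
  have hn : ‖(hubAt a₀ σ).im‖ = Real.sqrt σ := by
    rw [← Real.sqrt_sq (norm_nonneg (hubAt a₀ σ).im), h2, Real.sqrt_sq (Real.sqrt_nonneg σ)]
  show (⟨(hubAt a₀ σ).re, ‖(hubAt a₀ σ).im‖, 0, 0⟩ : ℍ) = hubAt a₀ σ
  rw [hn]; rfl

/-- `(a₀, σ) ↦ hubAt a₀ σ` is measurable. [folklore] -/
theorem measurable_hubAt : Measurable fun p : ℝ × ℝ => hubAt p.1 p.2 := by
  have h : (fun p : ℝ × ℝ => hubAt p.1 p.2) = fun p => (⟨p.1, Real.sqrt p.2, 0, 0⟩ : ℍ) := rfl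
  rw [h]
  exact (continuous_quat_mk continuous_fst (Real.continuous_sqrt.comp continuous_snd) continuous_const continuous_const).measurable

variable (L) in
/-- ★ **The fibre mass of the periodic blow-up at hub `a`**: `Ψ_t(a) = ∫⁻ w, vol^{Fol}(section of periodicBlowUpSet z χ t s at (a, w)) dvol³`
(the inner double integral of ✓`ringMeasure_ringDeficit_le_eq_hub`). [folklore] -/
def periodicFibreMass (z : Fin 3 → Bool) (χ : Site 3 L → SU2) (t s : ℝ) (a : ℍ) : ℝ≥0∞ :=
  ∫⁻ w, (Measure.pi fun _ : Fol L => (volume : Measure ℍ)) (Prod.mk w ⁻¹' (Prod.mk a ⁻¹' periodicBlowUpSet L z χ t s))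
    ∂(volume : Measure ((ℍ × ℍ) × ℍ))

/-- The section measure `(a, w) ↦ vol^{Fol}(section)` is jointly measurable. [folklore] -/
theorem measurable_section_periodicBlowUpSet (z : Fin 3 → Bool) (χ : Site 3 L → SU2) (t s : ℝ) :
    Measurable fun q : ℍ × ((ℍ × ℍ) × ℍ) =>
      (Measure.pi fun _ : Fol L => (volume : Measure ℍ)) (Prod.mk q.2 ⁻¹' (Prod.mk q.1 ⁻¹' periodicBlowUpSet L z χ t s)) := by
  have hE := measurableSet_periodicBlowUpSet z χ t s
  have hE' : MeasurableSet ((fun p : (ℍ × ((ℍ × ℍ) × ℍ)) × (Fol L → ℍ) => ((p.1.1, (p.1.2, p.2)) : ℍ × (((ℍ × ℍ) × ℍ) × (Fol L → ℍ)))) ⁻¹'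
      periodicBlowUpSet L z χ t s) :=
    hE.preimage ((measurable_fst.comp measurable_fst).prodMk ((measurable_snd.comp measurable_fst).prodMk measurable_snd))
  exact measurable_measure_prodMk_left (ν := (Measure.pi fun _ : Fol L => (volume : Measure ℍ))) hE'

/-- `Ψ_t` is measurable in the hub. [folklore] -/
theorem measurable_periodicFibreMass (z : Fin 3 → Bool) (χ : Site 3 L → SU2) (t s : ℝ) : Measurable (periodicFibreMass L z χ t s) :=
  (measurable_section_periodicBlowUpSet z χ t s).lintegral_prod_right'

/-- The blow-up event's sections depend on the hub only through `axisPoint a` (the periodic leader tuple reads `Q(axisPoint a)`). [folklore] -/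
theorem section_periodicBlowUpSet_eq_of_axisPoint (z : Fin 3 → Bool) (χ : Site 3 L → SU2) (t s : ℝ) {a b : ℍ} (hab : axisPoint a = axisPoint b)
    (w : (ℍ × ℍ) × ℍ) : Prod.mk w ⁻¹' (Prod.mk a ⁻¹' periodicBlowUpSet L z χ t s) = Prod.mk w ⁻¹' (Prod.mk b ⁻¹' periodicBlowUpSet L z χ t s) := by
  ext y
  simp only [Set.mem_preimage, periodicBlowUpSet, periodicBlowUpPoint, Set.mem_setOf_eq, axialLetters, hab]

/-- ★ **`Ψ_t(a) = Ψ_t(hubAt a₀ ‖Im a‖²)`**: the fibre mass is a function of `(a₀, ‖Im a‖²)`. [folklore] -/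
theorem periodicFibreMass_eq_hubAt (z : Fin 3 → Bool) (χ : Site 3 L → SU2) (t s : ℝ) (a : ℍ) :
    periodicFibreMass L z χ t s a = periodicFibreMass L z χ t s (hubAt a.re (‖a.im‖ ^ 2)) := by
  unfold periodicFibreMass
  refine lintegral_congr fun w => ?_
  rw [section_periodicBlowUpSet_eq_of_axisPoint z χ t s (show axisPoint a = axisPoint (hubAt a.re (‖a.im‖ ^ 2)) by
    rw [axisPoint_hubAt, axisPoint_eq_hubAt])]

/-! ## §2 The log-squeeze kernel -/

variable (L) in
/-- ★★ **The periodic log-squeeze kernel** on `X × (0,∞) = ℝ × (0,∞) ∋ (a₀, ρ)` (hub real part, hub transverse radius `ρ = ‖Im a‖`):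
`K_t(a₀, ρ) = 4π · 𝟙{a₀² + ρ² < 1} · ρ² · Ψ_t(hubAt a₀ ρ²)` — the radial weight of ✓`lintegral_coneMeasure_re_normSqIm'`. [folklore] -/
def periodicKernel (z : Fin 3 → Bool) (χ : Site 3 L → SU2) (t s : ℝ) (p : ℝ × ℝ) : ℝ≥0∞ :=
  ENNReal.ofReal (4 * Real.pi) * {ρ : ℝ | p.1 ^ 2 + ρ ^ 2 < 1}.indicator
    (fun ρ => ENNReal.ofReal (ρ ^ 2) * periodicFibreMass L z χ t s (hubAt p.1 (ρ ^ 2))) p.2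

/-- The kernel is jointly measurable in `(a₀, ρ)`. [folklore] -/
theorem measurable_periodicKernel (z : Fin 3 → Bool) (χ : Site 3 L → SU2) (t s : ℝ) : Measurable (periodicKernel L z χ t s) := by
  have hΨ : Measurable fun p : ℝ × ℝ => periodicFibreMass L z χ t s (hubAt p.1 (p.2 ^ 2)) :=
    (measurable_periodicFibreMass z χ t s).comp (measurable_hubAt.comp (measurable_fst.prodMk (measurable_snd.pow_const 2)))
  have hF : Measurable fun p : ℝ × ℝ => ENNReal.ofReal (p.2 ^ 2) * periodicFibreMass L z χ t s (hubAt p.1 (p.2 ^ 2)) :=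
    (ENNReal.measurable_ofReal.comp (measurable_snd.pow_const 2)).mul hΨ
  have hS : MeasurableSet {p : ℝ × ℝ | p.1 ^ 2 + p.2 ^ 2 < 1} :=
    measurableSet_lt ((measurable_fst.pow_const 2).add (measurable_snd.pow_const 2)) measurable_const
  have e : periodicKernel L z χ t s = fun p => ENNReal.ofReal (4 * Real.pi) *
      {p : ℝ × ℝ | p.1 ^ 2 + p.2 ^ 2 < 1}.indicator (fun p => ENNReal.ofReal (p.2 ^ 2) * periodicFibreMass L z χ t s (hubAt p.1 (p.2 ^ 2))) p := by
    funext p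
    unfold periodicKernel
    congr 1
  rw [e]
  exact (hF.indicator hS).const_mul _

/-- ★★★ **THE PERIODIC SUBLEVEL VOLUME AS A HUB-RADIAL DOUBLE INTEGRAL** — literally the shape `∫⁻ x, (∫⁻ ρ in Ioi 0, K t (x, ρ)) ∂σ` of
✓`BlowUp.tendsto_div_log_of_twoScale` (`X = ℝ ∋ a₀`, `σ = vol`): for central `χ`, every `t > 0` and `s`,
`μ_L{F_z ≤ s} = ofReal(coneConst^{6L⁴+1}·t^{18L⁴−3}) · ∫⁻ a₀, (∫⁻ ρ in Ioi 0, periodicKernel z χ t s (a₀, ρ)) ∂vol`. [cite: Luscher1983, §2] [cite: GonzalezarroyoAltes1988] -/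
theorem ringMeasure_ringDeficit_le_eq_kernel (z : Fin 3 → Bool) {χ : Site 3 L → SU2} (hχ : ∀ (x : Site 3 L) (k : SU2), k * χ x = χ x * k)
    {t : ℝ} (ht : 0 < t) (s : ℝ) :
    (ringMeasure L) {P | ringDeficit L z P ≤ s} =
      ENNReal.ofReal (coneConst ^ (6 * L ^ 4 + 1) * t ^ (18 * L ^ 4 - 3)) *
        ∫⁻ a₀ : ℝ, (∫⁻ ρ in Ioi (0 : ℝ), periodicKernel L z χ t s (a₀, ρ)) ∂(volume : Measure ℝ) := by
  rw [ringMeasure_ringDeficit_le_eq_hub z hχ ht s]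
  -- the hub integrand is `Ψ_t(a) = F(a₀, ‖Im a‖²)` with `F a₀ σ = Ψ_t(hubAt a₀ σ)`
  have hF : Measurable (Function.uncurry fun a₀ σ : ℝ => periodicFibreMass L z χ t s (hubAt a₀ σ)) :=
    (measurable_periodicFibreMass z χ t s).comp measurable_hubAt
  have hΨ : (fun a : ℍ => ∫⁻ w, (Measure.pi fun _ : Fol L => (volume : Measure ℍ)) (Prod.mk w ⁻¹' (Prod.mk a ⁻¹' periodicBlowUpSet L z χ t s))
      ∂(volume : Measure ((ℍ × ℍ) × ℍ))) = fun a => (fun a₀ σ : ℝ => periodicFibreMass L z χ t s (hubAt a₀ σ)) a.re (‖a.im‖ ^ 2) := by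
    funext a
    exact periodicFibreMass_eq_hubAt z χ t s a
  rw [hΨ, lintegral_coneMeasure_re_normSqIm' _ hF]
  have hc0 : 0 ≤ coneConst := by rw [coneConst]; exact ENNReal.toReal_nonneg
  rw [← mul_assoc, ← ENNReal.ofReal_mul (by positivity)]
  congr 1
  · congr 1; ring
  · refine lintegral_congr fun a₀ => ?_
    rw [← lintegral_const_mul' _ _ ENNReal.ofReal_ne_top]
    refine lintegral_congr fun ρ => ?_
    unfold periodicKernel
    simp only

/-- ★★ The same at `t = √u` with the periodic exponent as a real power: `μ_L{F_z ≤ r·u} = ofReal(coneConst^{6L⁴+1}·u^{9L⁴−3/2}) · ∫⁻ a₀, (∫⁻ ρ in Ioi 0, K_{√u}(a₀, ρ)) ∂vol`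
(`K_{√u} = periodicKernel z χ (√u) (r·u)`).  Dividing by `ofReal(coneConst^{6L⁴+1}·u^{9L⁴−3/2})` and by `log(1/u) = 2·log(1/√u)` is the `I(t)/log(1/t)` of the
log-squeeze lemma. [cite: Luscher1983, §2] -/
theorem ringMeasure_ringDeficit_le_eq_kernel_sqrt (z : Fin 3 → Bool) {χ : Site 3 L → SU2} (hχ : ∀ (x : Site 3 L) (k : SU2), k * χ x = χ x * k)
    (r : ℝ) {u : ℝ} (hu : 0 < u) :
    (ringMeasure L) {P | ringDeficit L z P ≤ r * u} =
      ENNReal.ofReal (coneConst ^ (6 * L ^ 4 + 1) * u ^ (9 * (L : ℝ) ^ 4 - 3 / 2)) *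
        ∫⁻ a₀ : ℝ, (∫⁻ ρ in Ioi (0 : ℝ), periodicKernel L z χ (Real.sqrt u) (r * u) (a₀, ρ)) ∂(volume : Measure ℝ) := by
  rw [ringMeasure_ringDeficit_le_eq_kernel z hχ (Real.sqrt_pos.2 hu) (r * u)]
  congr 2
  have h4 : 1 ≤ L ^ 4 := Nat.one_le_pow _ _ (Nat.pos_of_ne_zero (NeZero.ne L))
  have hcast : (((18 * L ^ 4 - 3 : ℕ) : ℝ)) = 2 * (9 * (L : ℝ) ^ 4 - 3 / 2) := by
    rw [Nat.cast_sub (by omega)]; push_cast; ring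
  rw [← Real.rpow_natCast (Real.sqrt u) (18 * L ^ 4 - 3), hcast, Real.rpow_mul (Real.sqrt_nonneg u), Real.rpow_two, Real.sq_sqrt hu.le]

/-! ## §3 The hub-dependent second rescaling for integrands -/

/-- ★ **fcl-p3 g44's second rescaling for INTEGRANDS**: `∫⁻ H dvol³ = ofReal(|m·l²|)³ · ∫⁻ H (scaleQ3 m l w) dw` (`m·l² ≠ 0`; ✓`map_scaleQ3_volume`) — the
change of variables that exhibits the two-scale structure of the leaders' fibre at hub `(a₀, ρ)` (K4 III: `m, l` functions of the hub); the followers are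
not touched. [folklore] -/
theorem lintegral_volume3_eq_scaleQ3 {m l : ℝ} (h : m * l ^ 2 ≠ 0) (H : (ℍ × ℍ) × ℍ → ℝ≥0∞) (hH : Measurable H) :
    ∫⁻ w, H w ∂(((volume : Measure ℍ).prod (volume : Measure ℍ)).prod (volume : Measure ℍ)) =
      (ENNReal.ofReal (|m * l ^ 2|) * ENNReal.ofReal (|m * l ^ 2|) * ENNReal.ofReal (|m * l ^ 2|)) *
        ∫⁻ w, H (scaleQ3 m l w) ∂(((volume : Measure ℍ).prod (volume : Measure ℍ)).prod (volume : Measure ℍ)) := by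
  have habs : 0 < |m * l ^ 2| := abs_pos.2 h
  have h1 : ∫⁻ w, H (scaleQ3 m l w) ∂(((volume : Measure ℍ).prod (volume : Measure ℍ)).prod (volume : Measure ℍ)) =
      ∫⁻ w, H w ∂((((volume : Measure ℍ).prod (volume : Measure ℍ)).prod (volume : Measure ℍ)).map (scaleQ3 m l)) :=
    (lintegral_map hH (measurable_scaleQ3 m l)).symm
  rw [h1, map_scaleQ3_volume h, lintegral_smul_measure, smul_eq_mul, ← mul_assoc]
  have hinv : ENNReal.ofReal (|m * l ^ 2|) * ENNReal.ofReal (|m * l ^ 2|⁻¹) = 1 := by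
    rw [← ENNReal.ofReal_mul habs.le, mul_inv_cancel₀ habs.ne', ENNReal.ofReal_one]
  calc ∫⁻ w, H w ∂(((volume : Measure ℍ).prod (volume : Measure ℍ)).prod (volume : Measure ℍ))
      = (ENNReal.ofReal (|m * l ^ 2|) * ENNReal.ofReal (|m * l ^ 2|⁻¹)) * (ENNReal.ofReal (|m * l ^ 2|) * ENNReal.ofReal (|m * l ^ 2|⁻¹)) *
          (ENNReal.ofReal (|m * l ^ 2|) * ENNReal.ofReal (|m * l ^ 2|⁻¹)) *
          ∫⁻ w, H w ∂(((volume : Measure ℍ).prod (volume : Measure ℍ)).prod (volume : Measure ℍ)) := by simp only [hinv, one_mul]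
    _ = ENNReal.ofReal (|m * l ^ 2|) * ENNReal.ofReal (|m * l ^ 2|) * ENNReal.ofReal (|m * l ^ 2|) *
          (ENNReal.ofReal (|m * l ^ 2|⁻¹) * ENNReal.ofReal (|m * l ^ 2|⁻¹) * ENNReal.ofReal (|m * l ^ 2|⁻¹)) *
          ∫⁻ w, H w ∂(((volume : Measure ℍ).prod (volume : Measure ℍ)).prod (volume : Measure ℍ)) := by ring

end Summit.QuantumFields.YangMills.Theorems.SwapVirialDeficit.BlowUpRing

end
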